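import Mathlib
import Literature.NumberTheory.LFunctions.Zhang2022.Section4LLStripGrowth
import Literature.NumberTheory.LFunctions.Zhang2022.Section4PerronIntegrability
import Literature.Analysis.Complex.RectangleCauchyFormula
import HarnessLib

/-!
# Zhang (2022) §4, Lemma 4.4: preparation for "By the residue theorem, `L(s,ψ)L(s,ψχ) = (2πi)⁻¹(∫_{(1)} −
# ∫_{(−σ−1/2)}) L(s+w,ψ)L(s+w,ψχ)P^{(9/5)w}ω₁(w)dw/w`" (node `Section4.ResidueSplit`) — PROVED

Topic `Literature/NumberTheory/LFunctions/Zhang2022` (Landau–Siegel adjudication tree;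
verdict-neutral). Y. Zhang, *Discrete mean estimates and the Landau–Siegel zero*,
arXiv:2211.02515v1 (2022) [Zhang2022LandauSiegel] — **an unrefereed manuscript under adjudication**
— §4, proof of Lemma 4.4, p. 19 (tex L1049–L1052; DAG `Z22:§4.u025`):

> By the residue theorem,
> `L(s,ψ)L(s,ψχ) = (2πi)⁻¹(∫_{(1)} − ∫_{(−σ−1/2)}) L(s+w,ψ)L(s+w,ψχ)P^{(9/5)w} ω₁(w)dw/w`.

The campaign's statements file types this as the node `Section4.ResidueSplit`
(`Section4Statements.lean`, L1-t3): for every `ψ ∈ Ψ` and `s ∈ Ω₃`,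
`LL(s) = perronLine(LL(s+·), 1) − perronLine(LL(s+·), −σ−½)`. This file PROVES it
(`Section4.residueSplit_holds`, sibling file `Section4ResidueSplit.lean`; here: the PREPARATION —
integrability under polynomial bounds, the entire numerator `g`, the two line bounds; theorems
only, no definition, no new named fact):
Cauchy's formula on the rectangles `[−σ−½, 1] × [−V, V]` for the entire function
`g(w) = L(s+w,ψ)L(s+w,ψχ)P^{(9/5)w}ω₁(w)` and the simple pole of `g(w)/w` at `w = 0`
(the tree's `Literature.Analysis.Complex.integral_boundary_rect_div_sub_eq`), the horizontal sides
tending to `0` as `V → ∞` (polynomial growth of `L(z,ψ)L(z,ψχ)` in the strip,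
`Section4.norm_LL_le_strip`, against the Gaussian `|ω₁(u ± iV)| = e^{(u²−V²)/(4𝓛³⁰)}`), and the
vertical sides tending to the two absolutely convergent line integrals
(`Section4.integrable_perronIntegrand_of_le_pow`; on `Re w = 1` the crude bound
`‖L(z,θ)‖ ≤ k‖z‖Z`, on `Re w = −σ−½` the functional equation (4.4)
`Section4.LFunction_mul_LFunction_eq_of_re` with `Section4.norm_tildeZW_le_of_re`).

Nothing about Theorems 1–2 of the source or about Landau–Siegel zeros is stated or implied.

## References

* Y. Zhang, arXiv:2211.02515v1 (2022), §4 p. 19 (proof of Lemma 4.4, first display).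
  [cite: Zhang2022LandauSiegel, §4 Lemma 4.4 (proof) p. 19]
-/

noncomputable section

open Complex Real MeasureTheory Filter Topology intervalIntegral

namespace Literature.NumberTheory.LFunctions.Zhang2022.Section4

open Skeleton

/-! ### Integrability of a Perron integrand under a polynomial bound of any degree -/

/-- **Integrability of a Perron integrand** (any polynomial degree): if `f` is continuous on the line
`Re w = a ≠ 0` with `|f(a+iv)| ≤ A(1+|v|)ⁿ`, then `v ↦ f(w)P^{(9/5)w}ω₁(w)/w` (`w = a + iv`) is
integrable on `ℝ` — the Gaussian `|ω₁(a+iv)| = e^{(a²−v²)/(4𝓛³⁰)}` dominates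
(`(1+|v|)ⁿ ≤ e^{n|v|} ≤ e^{n²/(2b)}e^{bv²/2}`, `b = 1/(4𝓛³⁰)`). The degree-`2` case is
`Section4.integrable_perronIntegrand` of `Section4PerronIntegrability`.
[cite: Zhang2022LandauSiegel, §4 Lemma 4.4 (proof) p. 19] -/
theorem integrable_perronIntegrand_of_le_pow {D : ℕ} {a : ℝ} (ha : a ≠ 0) {f : ℂ → ℂ}
    (hf : Continuous fun v : ℝ => f (a + v * I)) {A : ℝ} {n : ℕ}
    (hA : ∀ v : ℝ, ‖f (a + v * I)‖ ≤ A * (1 + |v|) ^ n) (hL : 0 < ell D) :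
    Integrable fun v : ℝ => perronIntegrand D f (a + v * I) := by
  have hP : 0 < bigP D := Real.exp_pos _
  set b : ℝ := 1 / (4 * ell D ^ 30) with hb
  have hb0 : 0 < b := by rw [hb]; positivity
  set M : ℝ := bigP D ^ ((9 / 5 : ℝ) * a) * Real.exp (a ^ 2 / (4 * ell D ^ 30)) with hM
  have hM0 : 0 ≤ M := by rw [hM]; positivity
  set K : ℝ := A * M / |a| * Real.exp ((n : ℝ) ^ 2 / (2 * b)) with hK
  have hg : Integrable fun v : ℝ => K * Real.exp (-(b / 2) * v ^ 2) :=
    (integrable_exp_neg_mul_sq (by positivity : 0 < b / 2)).const_mul K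
  -- measurability
  have hcont : Continuous fun v : ℝ => perronIntegrand D f (a + v * I) := by
    have hw : ∀ v : ℝ, (a : ℂ) + v * I ≠ 0 := fun v h => ha (by simpa using congrArg Complex.re h)
    unfold perronIntegrand omega1W GaussWeight.omega1
    refine Continuous.div ?_ (by fun_prop) hw
    refine (hf.mul ?_).mul (by fun_prop)
    exact Continuous.const_cpow (by fun_prop) (Or.inl (by exact_mod_cast hP.ne'))
  refine hg.mono' hcont.aestronglyMeasurable (ae_of_all _ fun v => ?_)
  rw [norm_perronIntegrand]
  have hw : |a| ≤ ‖(a : ℂ) + v * I‖ := by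
    simpa using Complex.abs_re_le_norm ((a : ℂ) + v * I)
  have ha' : 0 < |a| := abs_pos.mpr ha
  have hexp : Real.exp ((a ^ 2 - v ^ 2) / (4 * ell D ^ 30))
      = Real.exp (a ^ 2 / (4 * ell D ^ 30)) * Real.exp (-b * v ^ 2) := by
    rw [← Real.exp_add, hb]; congr 1; ring
  have hA0 : 0 ≤ A := by
    have := le_trans (norm_nonneg _) (hA 0)
    simpa using this
  -- `(1+|v|)ⁿ ≤ e^{n|v|}` and `e^{n|v|} e^{−bv²} ≤ e^{n²/(2b)} e^{−bv²/2}`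
  have hpow : (1 + |v|) ^ n ≤ Real.exp ((n : ℝ) * |v|) := by
    calc (1 + |v|) ^ n ≤ (Real.exp |v|) ^ n :=
          pow_le_pow_left₀ (by positivity) (by linarith [Real.add_one_le_exp |v|]) n
      _ = Real.exp ((n : ℝ) * |v|) := by rw [← Real.exp_nat_mul]
  have hsq : (n : ℝ) * |v| + -b * v ^ 2 ≤ (n : ℝ) ^ 2 / (2 * b) + -(b / 2) * v ^ 2 := by
    have hv2 : v ^ 2 = |v| ^ 2 := (sq_abs v).symm
    rw [hv2]
    have key : 0 ≤ (b * |v| - n) ^ 2 := sq_nonneg _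
    have : (n : ℝ) * |v| ≤ (b / 2) * |v| ^ 2 + (n : ℝ) ^ 2 / (2 * b) := by
      rw [show (b / 2) * |v| ^ 2 + (n : ℝ) ^ 2 / (2 * b) = (b ^ 2 * |v| ^ 2 + (n : ℝ) ^ 2) / (2 * b) by
        field_simp]
      rw [le_div_iff₀ (by positivity)]
      nlinarith [key]
    linarith
  have hdom : (1 + |v|) ^ n * Real.exp (-b * v ^ 2)
      ≤ Real.exp ((n : ℝ) ^ 2 / (2 * b)) * Real.exp (-(b / 2) * v ^ 2) := by
    calc (1 + |v|) ^ n * Real.exp (-b * v ^ 2)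
        ≤ Real.exp ((n : ℝ) * |v|) * Real.exp (-b * v ^ 2) :=
          mul_le_mul_of_nonneg_right hpow (Real.exp_pos _).le
      _ = Real.exp ((n : ℝ) * |v| + -b * v ^ 2) := by rw [Real.exp_add]
      _ ≤ Real.exp ((n : ℝ) ^ 2 / (2 * b) + -(b / 2) * v ^ 2) := Real.exp_le_exp.mpr hsq
      _ = _ := by rw [Real.exp_add]
  rw [hexp]
  calc ‖f (a + v * I)‖ * bigP D ^ ((9 / 5 : ℝ) * a) *
        (Real.exp (a ^ 2 / (4 * ell D ^ 30)) * Real.exp (-b * v ^ 2)) / ‖(a : ℂ) + v * I‖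
      = ‖f (a + v * I)‖ * (M * Real.exp (-b * v ^ 2)) / ‖(a : ℂ) + v * I‖ := by rw [hM]; ring
    _ ≤ A * (1 + |v|) ^ n * (M * Real.exp (-b * v ^ 2)) / ‖(a : ℂ) + v * I‖ := by
        gcongr
        exact hA v
    _ ≤ A * (1 + |v|) ^ n * (M * Real.exp (-b * v ^ 2)) / |a| :=
        div_le_div_of_nonneg_left (by positivity) ha' hw
    _ = A * M / |a| * ((1 + |v|) ^ n * Real.exp (-b * v ^ 2)) := by ring
    _ ≤ A * M / |a| * (Real.exp ((n : ℝ) ^ 2 / (2 * b)) * Real.exp (-(b / 2) * v ^ 2)) :=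
        mul_le_mul_of_nonneg_left hdom (by positivity)
    _ = K * Real.exp (-(b / 2) * v ^ 2) := by rw [hK]; ring

/-! ### The entire function `g(w) = L(s+w,ψ)L(s+w,ψχ)P^{(9/5)w}ω₁(w)` and its size -/

section WithCharacter

variable {D : ℕ} [NeZero D] (χ : DirichletCharacter ℂ D) (x : Chr D)

/-- `g(w)/w` is the Perron integrand of `w ↦ L(s+w,ψ)L(s+w,ψχ)`. [cite: Zhang2022LandauSiegel, §4 Lemma 4.4 (proof) p. 19] -/
theorem perronIntegrand_eq_div (s w : ℂ) :
    perronIntegrand D (fun w => LL χ x (s + w)) w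
      = (LL χ x (s + w) * (bigP D : ℂ) ^ ((9 / 5 : ℂ) * w) * omega1W D w) / w := rfl

/-- `g` is entire (`ψ`, `ψχ` are non-principal for `D ≥ 3`, `χ` primitive).
[cite: Zhang2022LandauSiegel, §4 Lemma 4.4 (proof) p. 19] -/
theorem differentiable_numerator (hD : 3 ≤ D) (hχ : χ.IsPrimitive) (s : ℂ) :
    Differentiable ℂ fun w : ℂ =>
      LL χ x (s + w) * (bigP D : ℂ) ^ ((9 / 5 : ℂ) * w) * omega1W D w := by
  have hP : (bigP D : ℂ) ≠ 0 := by exact_mod_cast (Real.exp_pos _).ne'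
  have hLL : Differentiable ℂ (LL χ x) := differentiable_LL χ hD hχ x
  have h1 : Differentiable ℂ fun w : ℂ => LL χ x (s + w) :=
    hLL.comp (differentiable_id.const_add s)
  have h2 : Differentiable ℂ fun w : ℂ => (bigP D : ℂ) ^ ((9 / 5 : ℂ) * w) :=
    (differentiable_id.const_mul _).const_cpow (Or.inl hP)
  have h3 : Differentiable ℂ fun w : ℂ => omega1W D w := by
    unfold omega1W GaussWeight.omega1
    fun_prop
  exact (h1.mul h2).mul h3

/-- `g(0) = L(s,ψ)L(s,ψχ)` (`P⁰ = ω₁(0) = 1`). [cite: Zhang2022LandauSiegel, §4 Lemma 4.4 (proof) p. 19] -/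
theorem numerator_zero (s : ℂ) :
    LL χ x (s + 0) * (bigP D : ℂ) ^ ((9 / 5 : ℂ) * 0) * omega1W D 0 = LL χ x s := by
  simp [omega1W, GaussWeight.omega1]

/-! ### The two lines: polynomial bounds for `L(s+w,ψ)L(s+w,ψχ)` -/

/-- On `Re w = 1`: `|L(s+w,ψ)L(s+w,ψχ)| ≤ A(1+|v|)²` (`A = p·Dp·Z²(‖s‖+1)²`; crude bound
`‖L(z,θ)‖ ≤ k‖z‖Z` for `Re z ≥ 1/4`). [cite: Zhang2022LandauSiegel, §4 Lemma 4.4 (proof) p. 19] -/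
theorem norm_LL_line_one_le (hD : 3 ≤ D) (hχ : χ.IsPrimitive) {s : ℂ} (hs : 0 < s.re) (v : ℝ) :
    ‖LL χ x (s + (((1 : ℝ) : ℂ) + v * I))‖
      ≤ ((x.p : ℝ) * (∑' n : ℕ, ((n + 1 : ℕ) : ℝ) ^ (-(5 / 4 : ℝ))))
        * (((D * x.p : ℕ) : ℝ) * (∑' n : ℕ, ((n + 1 : ℕ) : ℝ) ^ (-(5 / 4 : ℝ))))
        * (‖s‖ + 1) ^ 2 * (1 + |v|) ^ 2 := by
  set Z : ℝ := ∑' n : ℕ, ((n + 1 : ℕ) : ℝ) ^ (-(5 / 4 : ℝ)) with hZ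
  have hZ0 : 0 ≤ Z := le_trans zero_le_one DirichletZFR.one_le_tsum_rpow
  set z : ℂ := s + (((1 : ℝ) : ℂ) + v * I) with hz
  have hre : (1 / 4 : ℝ) ≤ z.re := by rw [hz]; simp; linarith
  have hzn : ‖z‖ ≤ (‖s‖ + 1) * (1 + |v|) := by
    have h1 : ‖z‖ ≤ ‖s‖ + ‖(((1 : ℝ) : ℂ) + v * I)‖ := norm_add_le _ _
    have h2 : ‖(((1 : ℝ) : ℂ) + v * I)‖ ≤ 1 + |v| := by
      refine (norm_add_le _ _).trans ?_
      simp
    nlinarith [norm_nonneg s, abs_nonneg v]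
  have hψ := DirichletZFR.norm_LFunction_le_of_re_ge x.ψ x.ψ_ne_one hre
  have hψχ := DirichletZFR.norm_LFunction_le_of_re_ge (psiChi χ x) (psiChi_ne_one χ hD hχ x) hre
  rw [LL, norm_mul]
  have hb1 : ‖x.ψ.LFunction z‖ ≤ x.p * ((‖s‖ + 1) * (1 + |v|)) * Z := by
    calc ‖x.ψ.LFunction z‖ ≤ x.p * ‖z‖ * Z := hψ
      _ ≤ x.p * ((‖s‖ + 1) * (1 + |v|)) * Z := by gcongr
  have hb2 : ‖(psiChi χ x).LFunction z‖ ≤ ((D * x.p : ℕ) : ℝ) * ((‖s‖ + 1) * (1 + |v|)) * Z := by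
    calc ‖(psiChi χ x).LFunction z‖ ≤ ((D * x.p : ℕ) : ℝ) * ‖z‖ * Z := hψχ
      _ ≤ ((D * x.p : ℕ) : ℝ) * ((‖s‖ + 1) * (1 + |v|)) * Z := by gcongr
  calc ‖x.ψ.LFunction z‖ * ‖(psiChi χ x).LFunction z‖
      ≤ (x.p * ((‖s‖ + 1) * (1 + |v|)) * Z) * (((D * x.p : ℕ) : ℝ) * ((‖s‖ + 1) * (1 + |v|)) * Z) :=
        mul_le_mul hb1 hb2 (norm_nonneg _) (by positivity)
    _ = _ := by ring

/-- On `Re w = −σ − 1/2` (`Re(s+w) = −1/2`): `|L(s+w,ψ)L(s+w,ψχ)| ≤ A(1+|v|)⁴`, by the functional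
equation (4.4) on that line (`Section4.LFunction_mul_LFunction_eq_of_re`), `|Z̃| ≤ C(1+|z|)²` there
(`Section4.norm_tildeZW_le_of_re`) and the crude bound for the two `L(1−z, ·)` (`Re(1−z) = 3/2`).
[cite: Zhang2022LandauSiegel, §4 Lemma 4.4 (proof) p. 19] -/
theorem norm_LL_line_left_le (hD : 3 ≤ D) (hχ : χ.IsPrimitive) (s : ℂ) (v : ℝ) :
    ‖LL χ x (s + ((((-s.re - 1 / 2 : ℝ)) : ℂ) + v * I))‖
      ≤ ((‖GammaFactor.tau x.ψ‖ * (x.p : ℝ) ^ (1 / 2 : ℝ)) *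
          (‖GammaFactor.tau (psiChi χ x)‖ * ((D * x.p : ℕ) : ℝ) ^ (1 / 2 : ℝ)))
        * (((x.p : ℝ) * (∑' n : ℕ, ((n + 1 : ℕ) : ℝ) ^ (-(5 / 4 : ℝ))))
          * (((D * x.p : ℕ) : ℝ) * (∑' n : ℕ, ((n + 1 : ℕ) : ℝ) ^ (-(5 / 4 : ℝ)))))
        * (‖s‖ + |s.re| + 3) ^ 4 * (1 + |v|) ^ 4 := by
  set Z : ℝ := ∑' n : ℕ, ((n + 1 : ℕ) : ℝ) ^ (-(5 / 4 : ℝ)) with hZ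
  have hZ0 : 0 ≤ Z := le_trans zero_le_one DirichletZFR.one_le_tsum_rpow
  set z : ℂ := s + ((((-s.re - 1 / 2 : ℝ)) : ℂ) + v * I) with hz
  have hre : z.re = -1 / 2 := by rw [hz]; simp; ring
  have hre' : (1 / 4 : ℝ) ≤ (1 - z).re := by simp [hre]; norm_num
  have hDp : D * x.p ≠ 1 := fun h => x.p_ne_one (Nat.eq_one_of_mul_eq_one_left h)
  have hprim := psiChiPrimitive_holds D χ x hD hχ
  -- sizes of `z`, `1 − z`
  set T : ℝ := (‖s‖ + |s.re| + 3) * (1 + |v|) with hT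
  have hzn : 1 + ‖z‖ ≤ T := by
    have h1 : ‖z‖ ≤ ‖s‖ + ‖((((-s.re - 1 / 2 : ℝ)) : ℂ) + v * I)‖ := norm_add_le _ _
    have h2 : ‖((((-s.re - 1 / 2 : ℝ)) : ℂ) + v * I)‖ ≤ |s.re| + 1 / 2 + |v| := by
      have hre2 : |(-s.re - 1 / 2 : ℝ)| ≤ |s.re| + 1 / 2 := by
        rw [show (-s.re - 1 / 2 : ℝ) = -(s.re + 1 / 2) by ring, abs_neg]
        exact (abs_add_le _ _).trans (by norm_num)
      calc ‖((((-s.re - 1 / 2 : ℝ)) : ℂ) + v * I)‖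
          ≤ ‖(((-s.re - 1 / 2 : ℝ)) : ℂ)‖ + ‖(v : ℂ) * I‖ := norm_add_le _ _
        _ = |(-s.re - 1 / 2 : ℝ)| + |v| := by
            rw [Complex.norm_real, Real.norm_eq_abs]; simp
        _ ≤ |s.re| + 1 / 2 + |v| := by linarith
    rw [hT]; nlinarith [norm_nonneg s, abs_nonneg v, abs_nonneg s.re]
  have h1z : ‖1 - z‖ ≤ T := le_trans ((norm_sub_le _ _).trans (by simp)) hzn
  have hT0 : 0 ≤ T := le_trans (by positivity) hzn
  -- the three factors
  have hFE := LFunction_mul_LFunction_eq_of_re x.prim x.p_ne_one hprim hDp hre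
  have hZt : ‖GammaFactor.tildeZ x.ψ (psiChi χ x) z‖
      ≤ (‖GammaFactor.tau x.ψ‖ * (x.p : ℝ) ^ (1 / 2 : ℝ)) *
        (‖GammaFactor.tau (psiChi χ x)‖ * ((D * x.p : ℕ) : ℝ) ^ (1 / 2 : ℝ)) * T ^ 2 := by
    have h := norm_tildeZW_le_of_re χ x hre
    rw [tildeZW] at h
    refine h.trans ?_
    gcongr
  have hψ1 : (x.ψ)⁻¹ ≠ 1 := fun h => x.ψ_ne_one (inv_eq_one.mp h)
  have hψχ1 : (psiChi χ x)⁻¹ ≠ 1 := fun h => psiChi_ne_one χ hD hχ x (inv_eq_one.mp h)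
  have hL1 := DirichletZFR.norm_LFunction_le_of_re_ge (x.ψ)⁻¹ hψ1 hre'
  have hL2 := DirichletZFR.norm_LFunction_le_of_re_ge (psiChi χ x)⁻¹ hψχ1 hre'
  have hb1 : ‖(x.ψ)⁻¹.LFunction (1 - z)‖ ≤ x.p * T * Z :=
    hL1.trans (by gcongr)
  have hb2 : ‖(psiChi χ x)⁻¹.LFunction (1 - z)‖ ≤ ((D * x.p : ℕ) : ℝ) * T * Z :=
    hL2.trans (by gcongr)
  rw [LL, hFE, norm_mul, norm_mul]
  calc ‖GammaFactor.tildeZ x.ψ (psiChi χ x) z‖ *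
        (‖(x.ψ)⁻¹.LFunction (1 - z)‖ * ‖(psiChi χ x)⁻¹.LFunction (1 - z)‖)
      ≤ ((‖GammaFactor.tau x.ψ‖ * (x.p : ℝ) ^ (1 / 2 : ℝ)) *
          (‖GammaFactor.tau (psiChi χ x)‖ * ((D * x.p : ℕ) : ℝ) ^ (1 / 2 : ℝ)) * T ^ 2)
        * ((x.p * T * Z) * (((D * x.p : ℕ) : ℝ) * T * Z)) :=
        mul_le_mul hZt (mul_le_mul hb1 hb2 (norm_nonneg _) (by positivity)) (by positivity)
          (by positivity)
    _ = _ := by rw [hT]; ring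

end WithCharacter

end Literature.NumberTheory.LFunctions.Zhang2022.Section4

end
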